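import Summits.HodgeConjecture.HodgeConjecture.Theorems.TorelliForSymmetriesReflectionsDecide
import Summits.HodgeConjecture.HodgeConjecture.Theorems.TorelliForSymmetriesInvolutionsOfMiddle
import HarnessLib

/-!
# Assembly of route `TorelliForSymmetries` (stmt-HodgeConjecture-11029)

`ClassicalBettiDatum → InvolutionsAreCorrespondences → HodgeConjecture` (the frame "X → Statement").
Given the classical Betti–Hodge datum `B` (comparison compatible, with the Künneth–Hodge clause `K`)
and the target `InvolutionsAreCorrespondences` (every Hodge involution of `Hⁱ_B(X)` is induced by a
rational algebraic correspondence): for `X` smooth projective of dimension `n`, a codimension `p` and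
a polarization `P` of `H²ᵖ_B(X)` (`B.polarizable`), every `P`-reflection in a Hodge class is a
Hodge involution (`reflection_mem_endAlg`, `reflection_comp_self`), hence a correspondence; the
reflection lemma (`torelliForSymmetries_reflectionsDecide_proof`) gives `Hdgᵖ_B(X) = ℚ · Aᵖ_B(X)`
for all `p`, and the summit transfer for comparison-compatible data
(`IsComparisonCompatible.forall_hodgeConjectureFor`) concludes the Hodge conjecture.
-/

set_option linter.dupNamespace false

noncomputable section

namespace Summit.HodgeConjecture.HodgeConjecture.Theorems

open CategoryTheory MonoidalCategory
open Literature.AlgebraicGeometry.Motives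

/-- **Assembly of route `TorelliForSymmetries`** (item stmt-HodgeConjecture-11029):
`ClassicalBettiDatum → InvolutionsAreCorrespondences → HodgeConjecture`. See the module docstring.
[cite: VoisinHodgeI2002, §7.1.2 and §11.3] [cite: Deligne2000, §1] -/
theorem torelliForSymmetries_assembly_proof :
    Summit.HodgeConjecture.HodgeConjecture.Theses.TorelliForSymmetries.Assembly := by
  rintro ⟨B, hBcc, hK⟩ hInv n X hX
  refine hBcc.forall_hodgeConjectureFor (fun m Y hY p ↦ ?_) hX
  obtain ⟨P⟩ := B.polarizable hY (2 * p)
  have hpp : (p : ℤ) + p = ((2 * p : ℕ) : ℤ) := by push_cast; ring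
  refine torelliForSymmetries_reflectionsDecide_proof B hY p P fun v hv j' hj ↦ ?_
  let s : (B.hodge hY (2 * p)).endAlg :=
    ⟨LinearMap.id - (P.form.flip v).smulRight ((2 / P.form v v) • v),
      reflection_mem_endAlg P hpp hv _⟩
  exact hInv B hBcc hK hY (2 * p) j' hj (HodgeStructure.endAlg.toHom s) (reflection_comp_self P v)

end Summit.HodgeConjecture.HodgeConjecture.Theorems

end
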